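import Mathlib
import HarnessLib
import Summits.ValiantsHypothesis.ValiantsHypothesis.Theses.MonotoneRestoration
import Literature.Computability.AlgebraicComplexity.ArithCircuit
import Literature.Computability.AlgebraicComplexity.ArithCircuitProofs
import Literature.Computability.AlgebraicComplexity.MonotoneStructure
import Literature.Computability.AlgebraicComplexity.PermanentIrreducible
import Literature.ModelTheory.FiniteModelTheory.CkEquiv
import Summits.ValiantsHypothesis.ValiantsHypothesis.Theorems.MonotoneRestorationMonotoneRestorationQPCosetCount
import Summits.ValiantsHypothesis.ValiantsHypothesis.Theorems.MonotoneRestorationMonotoneRestorationQPSymmetricLB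
import Summits.ValiantsHypothesis.ValiantsHypothesis.Theorems.MonotoneRestorationMonotoneRestorationQPSupportSymmetrisation
import Summits.ValiantsHypothesis.ValiantsHypothesis.Theorems.MonotoneRestorationMonotoneRestorationQPSparseRegime
import Summits.ValiantsHypothesis.ValiantsHypothesis.Theorems.MonotoneRestorationMonotoneRestorationQPBeta
import Literature.Computability.AlgebraicComplexity.SymmetricArithCircuit
import Literature.Computability.AlgebraicComplexity.DawarWilsenach2025Proofs
import Literature.GroupTheory.PermutationGroups.SmallIndexSubgroups
import Summits.ValiantsHypothesis.ValiantsHypothesis.Theorems.MonotoneRestorationQP.Negative.LoadBearing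
import Summits.ValiantsHypothesis.ValiantsHypothesis.Theorems.MonotoneRestorationMonotoneRestorationQPPermSupportCount
import Literature.GroupTheory.PermutationGroups.SmallIndexSubgroupsAlternating

/-! TTRL-lite variant V18991 of stmt-ValiantsHypothesis-15886 -/

-- `Summit.<Summit>.<Problem>` is the tree's mandated summit-side namespace (CONVENTIONS §2); for this
-- single-conjunct summit the two coincide, so the duplicate is deliberate.
set_option linter.dupNamespace false

namespace Summit.ValiantsHypothesis.ValiantsHypothesis.Theorems

open Summit.ValiantsHypothesis.ValiantsHypothesis.Theses.MonotoneRestoration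
open Literature.Computability.AlgebraicComplexity

/-- **Variant V18991 of `stub_altFixing_orbit_dichotomy` (Jordan's bound, the load-bearing group
theory).**  For `m ≥ 5`, a subgroup of the alternating group `Alt(Fin m)` of index `< m` is the
whole group: the normal core of `H` is normal in the simple group `Alt(m)`
(`alternatingGroup.normal_subgroup_eq_bot_or_eq_top`), so it is `⊤` (then `H = ⊤`) or trivial, in
which case `Alt(m)` embeds in `Sym(Alt(m) ⧸ H)` and `m!/2 ≤ [Alt(m) : H]! ≤ (m - 1)!`, absurd.
This is the specialisation to `β = Fin m` of the landed Literature theorem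
`Literature.GroupTheory.PermutationGroups.alternatingGroup_subgroup_eq_top_of_index_lt_card`.
[cite: Rotman1995, Thm 3.11, Cor 3.15; DixonMortimer1996, Thm 5.2A (r = 1)] -/
theorem stub_altFixing_orbit_dichotomy_var18991 :
    ∀ (m : ℕ) (H : Subgroup (alternatingGroup (Fin m))), 5 ≤ m → H.index < m → H = ⊤ :=
  fun m H h5 hH =>
    Literature.GroupTheory.PermutationGroups.alternatingGroup_subgroup_eq_top_of_index_lt_card
      (β := Fin m) (by simpa only [Fintype.card_fin] using h5) H
      (by simpa only [Fintype.card_fin] using hH)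

end Summit.ValiantsHypothesis.ValiantsHypothesis.Theorems
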